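import Summits.ValiantsHypothesis.ValiantsHypothesis.Theorems.LacunarySymmetroidMatrixDescartesDoorA26WallBubblingConfluentCount

/-!
# Wall bubbling for `DoorA26` — THREE Weyl pairs: the THREE-PAIR confluent `(2,6)` determinant has `18` slots, `≤ 17` zeros with multiplicity

LINE / STUBS.  Crux `Theses.LacunarySymmetroid.DoorA26` (stmt-ValiantsHypothesis-19979; OPEN, typed, never asserted), line
`Cruxes/DoorA26/Lines/wall_bubbling.lean` (val-idea-15), obligation (W) `Stmt.stub_weylFaces`; statement file
`Cruxes/DoorA26/Lines/wall_bubbling_ConfluentDoor.lean` rev 4, stratum `Stmt.weylFaces_deepVal` with THREE Weyl pairs (three distinct values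
`e₀, e₁, e₂`, each carried by two letters; value-generic = no mixed relation `2e_a = e_b + e_c`).  Seat val-sym-door-p2 g13 (W1 #30); companion of
W1 #24 `…DoublyConfluentCount` (two pairs).

THE ESCAPE OBJECT AT THREE WEYL PAIRS.  By the frame identity with THREE divided differences (next files) the Gram-normalised limit of any cluster of a
sequence of `(2,6)` pencils whose exponents converge to a three-Weyl-pair point is the determinant of a pencil with THREE AFFINE LETTERS

  `F(t) = det( Σ_{a<3} e^{e_a t}(τ_a + t·T_a) )`,   `τ_a, T_a ∈ Sym₂(ℝ)`.

This file is its COUNT (def-free, determinant written inline, `E : Fin 3 → ℝ`, `τ T : Fin 3 → Sym₂(ℝ)`):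

* `threePairDet_extSum` — `F = Σ_{w ∈ F} P_w(t)e^{wt}` over the pair sums of `E`, every `P_w` of degree `≤ 2`;
* `card_pairSums_three` (`|F| ≤ 6`; `≤ 5` under a coincidence of two distinct canonical pairs, i.e. a mixed relation);
* **`threePairDet_zerosWithMultiplicity_le_seventeen`** — if `F ≢ 0` its real zeros WITH multiplicity number `≤ 17` for EVERY `E` (slots
  `6·3 = 18`: each of the three classes `e_a + e_b`, `a ≠ b`, has FOUR members but only the three slot functions `{1,t,t²}e^{(e_a+e_b)t}`);
  `…_le_fourteen_of_coincidence`; `threePair_count_conclusion` (the `Σ m ≤ 17 ≤ 19` shape the window step consumes).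

Nothing in this file bears on (W)/(M)/(R) themselves, on `DoorA26`, on `MatrixDescartes` (stmt-ValiantsHypothesis-18050) or on `VP ≠ VNP`;
registers unchanged.  `--supports stmt-ValiantsHypothesis-19979 --as helper`.  [folklore: Laguerre 1898; Pólya–Szegő 1976 Part V]
[this work] the slot bookkeeping.
-/

-- `Summit.ValiantsHypothesis.ValiantsHypothesis.…` repeats a component by the D-0017 layout
-- (single-conjunct summit), which the `dupNamespace` linter flags; the name is mandated.
set_option linter.dupNamespace false

namespace Summit.ValiantsHypothesis.ValiantsHypothesis.Theorems.LacunarySymmetroidMatrixDescartes.WallBubbling.Bubbling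

open Finset Filter Topology Polynomial
open Literature.Analysis.TotalPositivity.LaguerreRuleOfSigns (ZerosWithMultiplicityLE)

/-! ## 1. The three-pair determinant as an extended exponential sum -/

/-- **The three-pair confluent determinant is an extended exponential sum with all slot polynomials of degree `≤ 2`.** [folklore] -/
theorem threePairDet_extSum (E : Fin 3 → ℝ) (τ T : Fin 3 → Matrix (Fin 2) (Fin 2) ℝ) :
    ∃ P : ℝ → ℝ[X],
      (∀ t : ℝ, (∑ a, (Real.exp (E a * t)) • (τ a + t • T a)).det
        = ∑ w ∈ (univ : Finset (Fin 3 × Fin 3)).image (fun p => E p.1 + E p.2), (P w).eval t * Real.exp (w * t)) ∧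
      (∀ w, (P w).natDegree ≤ 2) := by
  classical
  -- polynomial letters
  let L : Fin 3 → Matrix (Fin 2) (Fin 2) ℝ[X] := fun a => (τ a).map C + (X : ℝ[X]) • (T a).map C
  have hL : ∀ a i j, L a i j = C (τ a i j) + X * C (T a i j) := by
    intro a i j
    show ((τ a).map C + (X : ℝ[X]) • (T a).map C) i j = _
    rw [Matrix.add_apply, Matrix.smul_apply, Matrix.map_apply, Matrix.map_apply, smul_eq_mul, mul_comm]
  have hdeg : ∀ a i j, (L a i j).natDegree ≤ 1 := by
    intro a i j
    rw [hL]
    refine (natDegree_add_le _ _).trans ?_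
    rw [natDegree_C, Nat.zero_max]
    refine (natDegree_mul_le).trans ?_
    rw [natDegree_C, add_zero]
    exact natDegree_X_le
  have heval : ∀ (i j : Fin 2) (t : ℝ), (∑ a, (Real.exp (E a * t)) • (τ a + t • T a)) i j
      = ∑ a, Real.exp (E a * t) * (L a i j).eval t := by
    intro i j t
    rw [Matrix.sum_apply]
    refine Finset.sum_congr rfl fun a _ => ?_
    rw [Matrix.smul_apply, Matrix.add_apply, Matrix.smul_apply, smul_eq_mul, smul_eq_mul, hL]
    simp only [eval_add, eval_mul, eval_C, eval_X, mul_comm t]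
  -- the pair terms and the coefficient polynomials
  let term : Fin 3 × Fin 3 → ℝ[X] := fun p => L p.1 0 0 * L p.2 1 1 - L p.1 0 1 * L p.2 1 0
  let F : Finset ℝ := (univ : Finset (Fin 3 × Fin 3)).image (fun p => E p.1 + E p.2)
  let P : ℝ → ℝ[X] := fun w => ∑ p ∈ (univ : Finset (Fin 3 × Fin 3)).filter (fun p => E p.1 + E p.2 = w), term p
  refine ⟨P, fun t => ?_, fun w => ?_⟩
  · rw [Matrix.det_fin_two, heval 0 0 t, heval 1 1 t, heval 0 1 t, heval 1 0 t]
    have hexp : ∀ p : Fin 3 × Fin 3, Real.exp (E p.1 * t) * Real.exp (E p.2 * t) = Real.exp ((E p.1 + E p.2) * t) := by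
      intro p; rw [← Real.exp_add]; ring_nf
    have hpairs : (∑ a, Real.exp (E a * t) * (L a 0 0).eval t) * (∑ a, Real.exp (E a * t) * (L a 1 1).eval t)
        - (∑ a, Real.exp (E a * t) * (L a 0 1).eval t) * (∑ a, Real.exp (E a * t) * (L a 1 0).eval t)
        = ∑ p : Fin 3 × Fin 3, (term p).eval t * Real.exp ((E p.1 + E p.2) * t) := by
      rw [← Finset.univ_product_univ, Finset.sum_product, Finset.sum_mul_sum, Finset.sum_mul_sum, ← Finset.sum_sub_distrib]
      refine Finset.sum_congr rfl fun a _ => ?_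
      rw [← Finset.sum_sub_distrib]
      refine Finset.sum_congr rfl fun b _ => ?_
      simp only [term, eval_sub, eval_mul]
      rw [← hexp (a, b)]
      ring
    rw [hpairs]
    symm
    rw [← Finset.sum_fiberwise_of_maps_to (s := (univ : Finset (Fin 3 × Fin 3))) (t := F) (g := fun p => E p.1 + E p.2)
      (fun p hp => Finset.mem_image_of_mem _ hp)]
    refine Finset.sum_congr rfl fun w _ => ?_
    simp only [P, eval_finsetSum, Finset.sum_mul]
    refine Finset.sum_congr rfl fun p hp => ?_
    rw [(Finset.mem_filter.mp hp).2]
  · refine (natDegree_sum_le_of_forall_le _ _ fun p _ => ?_)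
    refine (natDegree_sub_le _ _).trans (max_le ?_ ?_)
    · exact natDegree_mul_le.trans (by have := hdeg p.1 0 0; have := hdeg p.2 1 1; omega)
    · exact natDegree_mul_le.trans (by have := hdeg p.1 0 1; have := hdeg p.2 1 0; omega)

/-! ## 2. Slot count -/

/-- The set of pair sums of three reals has at most `6` elements, and at most `5` if two distinct canonical pairs have the same sum. [folklore] -/
theorem card_pairSums_three (E : Fin 3 → ℝ) :
    ((univ : Finset (Fin 3 × Fin 3)).image (fun p => E p.1 + E p.2)).card ≤ 6 ∧
    ((∃ a b c d : Fin 3, a ≤ b ∧ c ≤ d ∧ (a, b) ≠ (c, d) ∧ E a + E b = E c + E d) →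
      ((univ : Finset (Fin 3 × Fin 3)).image (fun p => E p.1 + E p.2)).card ≤ 5) := by
  classical
  set Cn : Finset (Fin 3 × Fin 3) := univ.filter (fun p => p.1 ≤ p.2) with hCn
  have hCcard : Cn.card = 6 := by rw [hCn]; decide
  have hsub : (univ : Finset (Fin 3 × Fin 3)).image (fun p => E p.1 + E p.2) ⊆ Cn.image (fun p => E p.1 + E p.2) := by
    intro w hw
    obtain ⟨p, -, rfl⟩ := Finset.mem_image.mp hw
    rcases le_total p.1 p.2 with h | h
    · exact Finset.mem_image.mpr ⟨p, Finset.mem_filter.mpr ⟨Finset.mem_univ _, h⟩, rfl⟩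
    · exact Finset.mem_image.mpr ⟨(p.2, p.1), Finset.mem_filter.mpr ⟨Finset.mem_univ _, h⟩, by simp [add_comm]⟩
  refine ⟨?_, ?_⟩
  · calc _ ≤ (Cn.image (fun p => E p.1 + E p.2)).card := Finset.card_le_card hsub
      _ ≤ Cn.card := Finset.card_image_le
      _ = 6 := hCcard
  · rintro ⟨a, b, c, d, hab, hcd, hne, hsum⟩
    have hab' : (a, b) ∈ Cn.erase (c, d) := Finset.mem_erase.mpr ⟨hne, Finset.mem_filter.mpr ⟨Finset.mem_univ _, hab⟩⟩
    have hsub' : Cn.image (fun p => E p.1 + E p.2) ⊆ (Cn.erase (c, d)).image (fun p => E p.1 + E p.2) := by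
      intro w hw
      obtain ⟨q, hq, rfl⟩ := Finset.mem_image.mp hw
      by_cases hqc : q = (c, d)
      · subst hqc
        exact Finset.mem_image.mpr ⟨(a, b), hab', hsum⟩
      · exact Finset.mem_image.mpr ⟨q, Finset.mem_erase.mpr ⟨hqc, hq⟩, rfl⟩
    have hcd' : (c, d) ∈ Cn := Finset.mem_filter.mpr ⟨Finset.mem_univ _, hcd⟩
    calc _ ≤ (Cn.image (fun p => E p.1 + E p.2)).card := Finset.card_le_card hsub
      _ ≤ ((Cn.erase (c, d)).image (fun p => E p.1 + E p.2)).card := Finset.card_le_card hsub'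
      _ ≤ (Cn.erase (c, d)).card := Finset.card_image_le
      _ = 5 := by rw [Finset.card_erase_of_mem hcd', hCcard]

/-! ## 3. Counts -/

/-- **Extended count of the three-pair determinant from the number of classes**: if `3·|F| ≤ N + 1` and `F ≢ 0`, at most `N` real zeros with
multiplicity. [folklore] -/
theorem threePairDet_zerosWithMultiplicity_le (N : ℕ) (E : Fin 3 → ℝ) (τ T : Fin 3 → Matrix (Fin 2) (Fin 2) ℝ)
    (hN : 3 * ((univ : Finset (Fin 3 × Fin 3)).image (fun p => E p.1 + E p.2)).card ≤ N + 1)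
    (hne : ∃ t : ℝ, (∑ a, (Real.exp (E a * t)) • (τ a + t • T a)).det ≠ 0) :
    ZerosWithMultiplicityLE (fun t : ℝ => (∑ a, (Real.exp (E a * t)) • (τ a + t • T a)).det) Set.univ N := by
  classical
  obtain ⟨P, hrep, hdegP⟩ := threePairDet_extSum E τ T
  set F := (univ : Finset (Fin 3 × Fin 3)).image (fun p => E p.1 + E p.2) with hF
  have hact : ∃ w ∈ F, P w ≠ 0 := by
    by_contra h
    push Not at h
    obtain ⟨t, ht⟩ := hne
    exact ht (by rw [hrep t]; exact Finset.sum_eq_zero fun w hw => by rw [h w hw, eval_zero, zero_mul])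
  have hslots : (∑ w ∈ F, if P w = 0 then 0 else (P w).natDegree + 1) ≤ N + 1 := by
    have h1 : (∑ w ∈ F, if P w = 0 then 0 else (P w).natDegree + 1) ≤ ∑ w ∈ F, 3 := by
      refine Finset.sum_le_sum fun w _ => ?_
      have := hdegP w
      split_ifs <;> omega
    rw [Finset.sum_const, smul_eq_mul] at h1
    linarith [h1]
  rw [show (fun t : ℝ => (∑ a, (Real.exp (E a * t)) • (τ a + t • T a)).det) = _ from funext hrep]
  exact extSum_zerosWithMultiplicity_le N _ P hact hslots

/-- **THE THREE-PAIR CONFLUENT `(2,6)` DETERMINANT HAS AT MOST `17` REAL ZEROS WITH MULTIPLICITY — UNCONDITIONALLY** (slots `≤ 18`). [this work] -/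
theorem threePairDet_zerosWithMultiplicity_le_seventeen (E : Fin 3 → ℝ) (τ T : Fin 3 → Matrix (Fin 2) (Fin 2) ℝ)
    (hne : ∃ t : ℝ, (∑ a, (Real.exp (E a * t)) • (τ a + t • T a)).det ≠ 0) :
    ZerosWithMultiplicityLE (fun t : ℝ => (∑ a, (Real.exp (E a * t)) • (τ a + t • T a)).det) Set.univ 17 :=
  threePairDet_zerosWithMultiplicity_le 17 E τ T (by have := (card_pairSums_three E).1; omega) hne

/-- **`≤ 14` under a value coincidence** (a mixed relation `2e_a = e_b + e_c` among three distinct values; slots `≤ 15`). [this work] -/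
theorem threePairDet_zerosWithMultiplicity_le_fourteen_of_coincidence (E : Fin 3 → ℝ) (τ T : Fin 3 → Matrix (Fin 2) (Fin 2) ℝ)
    (hcoin : ∃ a b c d : Fin 3, a ≤ b ∧ c ≤ d ∧ (a, b) ≠ (c, d) ∧ E a + E b = E c + E d)
    (hne : ∃ t : ℝ, (∑ a, (Real.exp (E a * t)) • (τ a + t • T a)).det ≠ 0) :
    ZerosWithMultiplicityLE (fun t : ℝ => (∑ a, (Real.exp (E a * t)) • (τ a + t • T a)).det) Set.univ 14 :=
  threePairDet_zerosWithMultiplicity_le 14 E τ T (by have := (card_pairSums_three E).2 hcoin; omega) hne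

/-- **The count in the window-step shape**: `∀ Z m, (∀ z ∈ Z, ∀ j < m z, iteratedDeriv j F z = 0) → Σ_{z∈Z} m z ≤ 17`. [this work] -/
theorem threePair_count_conclusion (E : Fin 3 → ℝ) (τ T : Fin 3 → Matrix (Fin 2) (Fin 2) ℝ)
    (hne : ∃ t : ℝ, (∑ a, (Real.exp (E a * t)) • (τ a + t • T a)).det ≠ 0)
    (Z : Finset ℝ) (m : ℝ → ℕ)
    (hZ : ∀ z ∈ Z, ∀ j < m z, iteratedDeriv j (fun t : ℝ => (∑ a, (Real.exp (E a * t)) • (τ a + t • T a)).det) z = 0) :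
    ∑ z ∈ Z, m z ≤ 17 :=
  threePairDet_zerosWithMultiplicity_le_seventeen E τ T hne Z m (fun z hz => ⟨Set.mem_univ _, hZ z hz⟩)

end Summit.ValiantsHypothesis.ValiantsHypothesis.Theorems.LacunarySymmetroidMatrixDescartes.WallBubbling.Bubbling
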